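import Summits.MatrixMultiplication.MatrixMultiplication.Theorems.SoloInformedRectangle
import Summits.MatrixMultiplication.MatrixMultiplication.Theorems.SoloInformedConstantClass

/-!
# Zero-class rigidity: the degenerate variants of THEOREM 8.19 are exact (THEOREM 8.22, case (β))

This work, §8.8 (T13)(i) and C3-m2 §5.7 (gen 107). Setting: a CU13-Def-12 realization of `⟨n,n,n⟩` in
`𝒮(S⁰ × S¹, ±)` [CohnUmans2013, arXiv:1207.6528, Def. 12] — equation data `D : Data ι G`, a chart `Φ`, full
separation, class map `κ : G → R` (`r = |R|`).

THEOREM 8.19 (a triple near-rectangle `a ≈ [v′]` on `I₀ × 𝓛`, `b ≈ [v]` on `𝓛 × K₀` closes) needs pins and the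
exception calculus for generic classes. Its degenerate variants need nothing: if `v = 0`, i.e. `b` VANISHES on
`𝓛 × K₀` outside a sparse set, then `a ∼ v′` holds EXACTLY on `I₀ × 𝓛` (`Data.a_signEq_of_b_zero`: two equations
through a common zero of `b` transport the class), and the rectangle bound (T5) ends; if `v′ = 0`, the rows `𝓛` of
`b` agree exactly on `K₀` and the lazy-row bound (T2a) ends.
* `signEq_of_adm_zero_mid`, `signEq_of_adm_zero_left` — `Adm x 0 w ⟹ w ∼ x`, `Adm 0 v w ⟹ w ∼ v`;
* `Data.a_signEq_of_b_zero`, `Data.b_signEq_of_a_zero` — the one-step transports;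
* `Data.a_signEq_of_b_nearZero`, `Data.b_signEq_of_a_nearZero` — near ⟹ exact (exception-set form);
* `Data.sq_mul_min_le_of_b_nearZero`, `Data.card_mul_le_of_a_nearZero` — the two rank bounds.
-/

namespace Summit.MatrixMultiplication.MatrixMultiplication.Theorems.TwistedTPP

namespace FibreLines

variable {ι G : Type*} [AddCommGroup G]

/-- `Adm x 0 w ⟹ w ∼ x`. -/
theorem signEq_of_adm_zero_mid {x w : G} (h : Adm x 0 w) : SignEq w x := by
  rcases h with h | h | h | h
  · right; rw [add_zero] at h; exact eq_neg_of_add_eq_zero_right h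
  · left; rw [add_zero, sub_eq_zero] at h; exact h.symm
  · right; rw [sub_zero] at h; exact eq_neg_of_add_eq_zero_right h
  · left; rw [sub_zero, sub_eq_zero] at h; exact h.symm

/-- `Adm 0 v w ⟹ w ∼ v`. -/
theorem signEq_of_adm_zero_left {v w : G} (h : Adm 0 v w) : SignEq w v := by
  rcases h with h | h | h | h
  · right; rw [zero_add] at h; exact eq_neg_of_add_eq_zero_right h
  · left; rw [zero_add, sub_eq_zero] at h; exact h.symm
  · left; rw [zero_sub, neg_add_eq_zero] at h; exact h.symm
  · right; rw [zero_sub, sub_eq_zero] at h; exact h.symm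

/-- **Transport through a common zero of `b`.** If `b(j,k) = b(j′,k) = 0` and `a(i,j′) ∼ v′` then `a(i,j) ∼ v′`
(the equations at `(i,j′,k)` and `(i,j,k)` both read `c(k,i)`). [C3-m2 §5.7, v = 0] -/
theorem Data.a_signEq_of_b_zero (D : Data ι G) {i j k j' : ι} {v' : G} (hjk : D.b j k = 0)
    (hj'k : D.b j' k = 0) (ha : SignEq (D.a i j') v') : SignEq (D.a i j) v' := by
  have h1 : SignEq (D.c k i) (D.a i j') := by
    have e := D.adm_eqn i j' k; rw [hj'k] at e; exact signEq_of_adm_zero_mid e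
  have h2 : SignEq (D.a i j) (D.c k i) := by
    have e := D.adm_eqn i j k; rw [hjk] at e; exact (signEq_of_adm_zero_mid e).symm
  exact h2.trans (h1.trans ha)

/-- **Transport through a common zero of `a`.** If `a(i,j) = a(i,j′) = 0` and `b(j′,k) ∼ v` then `b(j,k) ∼ v`.
[C3-m2 §5.7, v′ = 0] -/
theorem Data.b_signEq_of_a_zero (D : Data ι G) {i j k j' : ι} {v : G} (hij : D.a i j = 0)
    (hij' : D.a i j' = 0) (hb : SignEq (D.b j' k) v) : SignEq (D.b j k) v := by
  have h1 : SignEq (D.c k i) (D.b j' k) := by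
    have e := D.adm_eqn i j' k; rw [hij'] at e; exact signEq_of_adm_zero_left e
  have h2 : SignEq (D.b j k) (D.c k i) := by
    have e := D.adm_eqn i j k; rw [hij] at e; exact (signEq_of_adm_zero_left e).symm
  exact h2.trans (h1.trans hb)

/-- **Near ⟹ exact (`v = 0`).** If every row `j ∈ 𝓛` of `b` vanishes on `K₀` outside `≤ e` columns, every column
`k ∈ K₀` of `b` vanishes on `𝓛` outside `≤ e` rows, every row `i ∈ I₀` of `a` is `∼ v′` on `𝓛` outside `≤ e` columns,
and `e < |K₀|`, `2e < |𝓛|`, then `a ∼ v′` on ALL of `I₀ × 𝓛`. [C3-m2 §5.7] -/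
theorem Data.a_signEq_of_b_nearZero [DecidableEq ι] (D : Data ι G) {v' : G} (I₀ L K₀ : Finset ι) (e : ℕ)
    (hrow : ∀ j ∈ L, ∃ E : Finset ι, E.card ≤ e ∧ ∀ k ∈ K₀, k ∉ E → D.b j k = 0)
    (hcol : ∀ k ∈ K₀, ∃ E : Finset ι, E.card ≤ e ∧ ∀ j ∈ L, j ∉ E → D.b j k = 0)
    (ha : ∀ i ∈ I₀, ∃ E : Finset ι, E.card ≤ e ∧ ∀ j ∈ L, j ∉ E → SignEq (D.a i j) v')
    (hK : e < K₀.card) (hL : 2 * e < L.card) :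
    ∀ i ∈ I₀, ∀ j ∈ L, SignEq (D.a i j) v' := by
  intro i hi j hj
  obtain ⟨E₁, hE₁, hE₁z⟩ := hrow j hj
  obtain ⟨k, hk, hkE⟩ := Finset.exists_mem_notMem_of_card_lt_card (s := E₁) (t := K₀) (by omega)
  obtain ⟨E₂, hE₂, hE₂z⟩ := hcol k hk
  obtain ⟨E₃, hE₃, hE₃a⟩ := ha i hi
  obtain ⟨j', hj', hj'E⟩ := Finset.exists_mem_notMem_of_card_lt_card (s := E₂ ∪ E₃) (t := L) (by
    have := Finset.card_union_le E₂ E₃; omega)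
  rw [Finset.mem_union, not_or] at hj'E
  exact D.a_signEq_of_b_zero (hE₁z k hk hkE) (hE₂z j' hj' hj'E.1) (hE₃a j' hj' hj'E.2)

/-- **Near ⟹ exact (`v′ = 0`).** If every column `j ∈ 𝓛` of `a` vanishes on `I₀` outside `≤ e` rows, every row
`i ∈ I₀` of `a` vanishes on `𝓛` outside `≤ e` columns, every column `k ∈ K₀` of `b` is `∼ v` on `𝓛` outside `≤ e`
rows, and `e < |I₀|`, `2e < |𝓛|`, then `b ∼ v` on ALL of `𝓛 × K₀`. [C3-m2 §5.7] -/
theorem Data.b_signEq_of_a_nearZero [DecidableEq ι] (D : Data ι G) {v : G} (I₀ L K₀ : Finset ι) (e : ℕ)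
    (hcol : ∀ j ∈ L, ∃ E : Finset ι, E.card ≤ e ∧ ∀ i ∈ I₀, i ∉ E → D.a i j = 0)
    (hrow : ∀ i ∈ I₀, ∃ E : Finset ι, E.card ≤ e ∧ ∀ j ∈ L, j ∉ E → D.a i j = 0)
    (hb : ∀ k ∈ K₀, ∃ E : Finset ι, E.card ≤ e ∧ ∀ j ∈ L, j ∉ E → SignEq (D.b j k) v)
    (hI : e < I₀.card) (hL : 2 * e < L.card) :
    ∀ j ∈ L, ∀ k ∈ K₀, SignEq (D.b j k) v := by
  intro j hj k hk
  obtain ⟨E₁, hE₁, hE₁z⟩ := hcol j hj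
  obtain ⟨i, hi, hiE⟩ := Finset.exists_mem_notMem_of_card_lt_card (s := E₁) (t := I₀) (by omega)
  obtain ⟨E₂, hE₂, hE₂z⟩ := hrow i hi
  obtain ⟨E₃, hE₃, hE₃b⟩ := hb k hk
  obtain ⟨j', hj', hj'E⟩ := Finset.exists_mem_notMem_of_card_lt_card (s := E₂ ∪ E₃) (t := L) (by
    have := Finset.card_union_le E₂ E₃; omega)
  rw [Finset.mem_union, not_or] at hj'E
  exact D.b_signEq_of_a_zero (hE₁z i hi hiE) (hE₂z j' hj' hj'E.1) (hE₃b j' hj' hj'E.2)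

variable {G₀ : Type*} [AddCommGroup G₀] {R : Type*}

/-- **THEOREM 8.19, variant `v = 0`: the near-rectangle is an exact rectangle, and (T5) ends.**
`n² · min(|I₀|, |𝓛|/2) ≤ 2 · r · |S⁰|`. [C3-m2 §5.7] -/
theorem Data.sq_mul_min_le_of_b_nearZero [Fintype ι] [DecidableEq ι] [Fintype G₀] [DecidableEq G₀]
    [Fintype R] [DecidableEq R] (hG : ∀ x : G, x = -x → x = 0) (D : Data ι G) (Φ : Chart ι G₀)
    (κ : G → R) (hκ : ∀ x y, κ x = κ y → SignEq x y) (hsep : D.SepAll Φ) {v' : G}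
    (I₀ L K₀ : Finset ι) (e : ℕ)
    (hrow : ∀ j ∈ L, ∃ E : Finset ι, E.card ≤ e ∧ ∀ k ∈ K₀, k ∉ E → D.b j k = 0)
    (hcol : ∀ k ∈ K₀, ∃ E : Finset ι, E.card ≤ e ∧ ∀ j ∈ L, j ∉ E → D.b j k = 0)
    (ha : ∀ i ∈ I₀, ∃ E : Finset ι, E.card ≤ e ∧ ∀ j ∈ L, j ∉ E → SignEq (D.a i j) v')
    (hK : e < K₀.card) (hL : 2 * e < L.card) :
    Fintype.card ι ^ 2 * min I₀.card (L.card / 2) ≤ 2 * (Fintype.card R * Fintype.card G₀) :=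
  D.sq_mul_min_le_of_rect hG Φ κ hκ hsep I₀ L (fun _ => v') fun j hj i hi =>
    D.a_signEq_of_b_nearZero I₀ L K₀ e hrow hcol ha hK hL i hi j hj

/-- **THEOREM 8.19, variant `v′ = 0`: the rows `𝓛` of `b` agree exactly on `K₀`, and (T2a) ends.**
`n · |K₀| · |𝓛| ≤ r · |S⁰|`. [C3-m2 §5.7] -/
theorem Data.card_mul_le_of_a_nearZero [Fintype ι] [DecidableEq ι] [Fintype G₀] [DecidableEq G₀]
    [Fintype R] [DecidableEq R] (D : Data ι G) (Φ : Chart ι G₀) (κ : G → R)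
    (hκ : ∀ x y, κ x = κ y → SignEq x y) (hsep : D.SepAll Φ) {v : G} (I₀ L K₀ : Finset ι) (e : ℕ)
    (hcol : ∀ j ∈ L, ∃ E : Finset ι, E.card ≤ e ∧ ∀ i ∈ I₀, i ∉ E → D.a i j = 0)
    (hrow : ∀ i ∈ I₀, ∃ E : Finset ι, E.card ≤ e ∧ ∀ j ∈ L, j ∉ E → D.a i j = 0)
    (hb : ∀ k ∈ K₀, ∃ E : Finset ι, E.card ≤ e ∧ ∀ j ∈ L, j ∉ E → SignEq (D.b j k) v)
    (hI : e < I₀.card) (hL : 2 * e < L.card) :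
    Fintype.card ι * K₀.card * L.card ≤ Fintype.card R * Fintype.card G₀ := by
  have h := D.b_signEq_of_a_nearZero I₀ L K₀ e hcol hrow hb hI hL
  exact D.card_mul_le_of_b_rowsOn₂ Φ κ hκ hsep L K₀ fun j hj j' hj' k hk =>
    (h j' hj' k hk).trans (h j hj k hk).symm

end FibreLines

end Summit.MatrixMultiplication.MatrixMultiplication.Theorems.TwistedTPP
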